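import Summits.QuantumFields.YangMills.Theorems.BalabanUVNodesN16PinnedLooseMatchOfReg910Slot
import Summits.QuantumFields.YangMills.Theorems.BalabanUVNodesN16H5OfLettersB9SrcAllTorusPinned
import HarnessLib

/-!
# Route «BalabanUVNodes», crux K3⁷ `SpineGivenEndpointR13SepCoPH` v5 (941dddb108cbaacf) — node N16 = NE3: THE PRODUCER OF v5's THREE N16 CONJUNCTS WITH NODE N05 READ AS
# [Balaban1985BackgroundPropagators]'s FOUR LETTERS AND NODE N07 READ AT THE SLOT KEY — the slot-keyed TWIN of this seat's g3 file `…N16PinnedLooseMatchOfLettersB9Src` (p605535),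
# whose `hT : ∀ k, Thm1At (C F) (torusVP …)` binder is refuted at rank two (`…N16Thm1AtTorusVPSmallCubes.not_stub_thm1At`)

Cell `pub-ymgap`, width seat `pub-ymgap-dag-n16-w2` (g4), node N16.  `--kind proof --supports stmt-QuantumFields-20544 --as helper` (count-neutral; proves NO registered stub).
`bears_on: R4∕N16 · edges N05 → N16, N07 → N16 · out-edge N16 → N19 ∕ N21`.  One application each of dag-n16-e's module 47 `…N16PinnedLooseMatchOfReg910Slot`
(`exists_letters_n16HolderAtReading_loose_of_h5_reg910Slot_match[_n19rows]`, the slot-keyed twins of module 45) at `h5 := fun F => h5_of_lettersB9Src_allTorusPinned …`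
(this seat's file 1, p601904); nothing of anyone's re-declared.

WHY.  p605535's two producers display the bundle `(hGm, hG, hM, hT)`; `hT` (leaf-06's all-cube reading of (9)–(10), D-s3-3) is FALSE at `N = 2`, so they are vacuous as typed there.
The repaired N07 in-edge OF RECORD (plan g84 WORDS (B)) is dag-n16-w1 g5's SLOT KEY (T9ˢ) `hR` — Theorem 1's (9)–(10) at the (8)-class minimisers ON THE SLOT CUBES
`(x, F.L^(k+1) − 1 + F.L^(k+1) + 2)` — which the small-cube witness does not refute.  THIS FILE: the same two producers with `(hGm, hG, C, hR)`, conclusions VERBATIM.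

WHAT THIS FILE PROVES (BY NAME; 0 `def`, 0 `sorry`; `(M_N ℂ, 4, F.L)`, `[NeZero N]`, `0 ≤ β ≤ 1`):
* ★ `exists_letters_n16HolderAtReading_loose_of_lettersB9Src_reg910Slot_match` — hypotheses: `g F > 0`; the per-family LETTERS BUNDLE `hL` (= discharge-test v3∕v6L's `stub_lettersB9Src`
  text: length letter with N16's two lines, `inp`, thirteen constants under node N05's D9b guards, the four letters `SLet ∕ SLetUB ∕ SB9P ∕ SH59src` at every pinned all-torus member);
  `G hGm hG C hR` VERBATIM module 47's.  Conclusion = module 47's VERBATIM (`∃ ℓ₃ B, N16LettersEnd N g ℓ₃ ∧ (∀ F, 0 < B F ∧ (ℓ₃ F).ε ∕ B F ≤ (ℓ₃ F).b) ∧ (∀ F, (C F).B₃ ≤ B F) ∧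
  ∀ 𝔯, N16PinnedLoose 𝔯 ℓ₃ B → N16HolderAtReading 𝔯 β`).
* `exists_letters_n16HolderAtReading_loose_of_lettersB9Src_reg910Slot_match_n19rows` — the same over module 47's `…_match_n19rows` (node N19's two further radius guards).

HONEST FRAMING.  Composition BY NAME; no estimate; the four letters (N06's open content at the no-holes members, `m ≥ 1`) and the slot key `hR` (N07's) are HYPOTHESES inhabited
by nothing here; nothing of Bałaban asserted or refuted; no registered stub closed; **N16 ∕ N05 ∕ N06 ∕ N07 ∕ N19 NOT discharged**; count-neutral (typed 28∕28 · discharged 5∕27 ·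
A 5∕28 UNMOVED); one finite four-torus at fixed ε — NOT ℝ⁴ ∕ OS ∕ mass gap; the YM mass gap (Clay) is NOT proved — R4 closes the conditional finite-𝕋⁴ rung `BalabanLadder.UV` only.
No `sorry` ∕ `def` ∕ `instance` ∕ `notation`.
-/

set_option autoImplicit false

open scoped BigOperators Matrix Matrix.Norms.L2Operator
open NormedSpace

noncomputable section

namespace Summit.QuantumFields.YangMills.BalabanUVNodes.N16PinnedLooseMatchOfLettersB9SrcSlot

open Literature.MathematicalPhysics.QuantumFieldTheory.Balaban1983to89
open Literature.MathematicalPhysics.QuantumFieldTheory.Balaban1983to89.T4Continuum (T4Family)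
open B7Prop1Explicit B7Prop2Explicit MatrixLog UnitaryModel
open T4AveragingDeficitWall hiding Site Plane Plaq Bond
open Summit.QuantumFields.BalabanUV.T4Continuum
open B7Prop3Flat (c3) open B7Prop1Local (InBox)
open B8LeafModelZd (ZdIdx)
open B8LeafModelZd3 (zdGF3 SockB9P3)
open B8TowerBondsPrinted (towerBondsP)
open B8SockLettersRD (SockLettersRD)
open B8Lemma1NonAbelian (mulCfg)
open B8LanF146 (LanF146)
open B8Eq138LandauZd (covLap QT InR138)
open B7Eq92Concrete (mgauge)
open B8Ineq130 (tlo thi) open B8Ineq132 (InAk covDerivFwd) open B7Eq78Linearization (zdBlocking QprimeIter)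
open B8Eq119TwistedAxial (bgT Restr129 InAx) open B8Eq140Level (SideTouches) open B8Eq1117Concrete (XSpace) open B8Prop5ContractionKLevel (Bd2)
open B8LambdaSpaceKLevel (wt) open B8Eq184Proof (cfgExp) open B8Eq146AExpansion (iEta) open B7Prop4GeneralLevels (linCovIter)
open B8Eq155JBound (Jcur wsup) open B8ScaledSupNorm (bondNorm msup Bdd)
open Node00 (NE3Letters₁₁ ne3ConstLayerOfRecord₁₁ ne3NperOfRecord₁₁ ne3DomOfRecord₁₁ MatA)
open MinimalActionSandwich (IsMinimiser)
open MinimalActionRate (sfClass)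
open MinimalActionRefine (gradConst)
open MinimalActionDictionary (torusVP RadiiMono)
open AveragingDeficitLatticeH2Prep (fd)
open B11 (Regularity)
open B11Thm1 (Thm1At)
open YMDAG.UVSplit (RateReading₁₃CoPH)
open Summit.QuantumFields.YangMills.BalabanUVNodes.N16PinnedLayer13CoPH (N16PinnedLoose N16LettersEnd N16HolderAtReading)
open Summit.QuantumFields.YangMills.BalabanUVNodes.N16PinnedLooseMatchOfReg910Slot (exists_letters_n16HolderAtReading_loose_of_h5_reg910Slot_match
  exists_letters_n16HolderAtReading_loose_of_h5_reg910Slot_match_n19rows)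
open Summit.QuantumFields.YangMills.BalabanUVNodes.N16H5OfLettersB9SrcAllTorusPinned (h5_of_lettersB9Src_allTorusPinned)

variable {N : ℕ} [NeZero N]

section Producer

variable {β : ℝ} (hβ0 : 0 ≤ β) (hβ1 : β ≤ 1)
include hβ0 hβ1

/-- ★ **K3⁷ v5's THREE N16 CONJUNCTS OF THE STUB-1 WITNESS — `N16LettersEnd`, `N16RadiusMatch` (unfolded), and the N16 conjunct `N16HolderAtReading · β` at every reading pinned
`N16PinnedLoose · ℓ₃ B` — FROM [Balaban1985BackgroundPropagators]'s FOUR LETTERS AT THE PINNED MEMBERS AND [Balaban1985Variational] THEOREM 1's (9)–(10) AT THE SLOT CUBES (dag-n16-w1's key (T9ˢ))**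
(`0 ≤ β ≤ 1`; `B F := max (C F).B₃ ((ℓ₃ F).ε ∕ (ℓ₃ F).b)`, with `(C F).B₃ ≤ B F` displayed).  Hypotheses: `g F > 0`; the per-family letters bundle `hL` (length letter with N16's
two lines, input record `inp`, thirteen constants under node N05's D9b guards, and the four letters `SLet ∕ SLetUB ∕ SB9P ∕ SH59src` at every pinned all-torus member of
`(M_N ℂ, 4, F.L)`); the slot key `G hGm hG C hR` (module 47's, VERBATIM).  Conclusion: module 47's, VERBATIM.  Proof: dag-n16-e's module 47
`exists_letters_n16HolderAtReading_loose_of_h5_reg910Slot_match` at `h5 := fun F => h5_of_lettersB9Src_allTorusPinned F.hL.2 β …` — one application.  Nothing of Bałaban is proved: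
the letters are node N06's open content (truncations `m ≥ 1`), `hR` node N07's.
[cite: Balaban1985RegularSpaces, Thm 4 p.88, Prop. 3 p.87, (1.36) p.82, Thm 8 (1.146) p.101; Balaban1985BackgroundPropagators, Thm 3.1 p.397, Thm 3.3 p.398; Balaban1985Variational, Thm 1 (9)–(10) p.279] [folklore] -/
theorem exists_letters_n16HolderAtReading_loose_of_lettersB9Src_reg910Slot_match {g : T4Family → ℝ} (hg : ∀ F, 0 < g F)
    (hL : ∀ F : T4Family, letI : CStarAlgebra (Matrix (Fin N) (Fin N) ℂ) := {}
  ∃ (len : Site 4 → ℝ) (inp : B8.B9Inputs) (B₀β C₂ cB9 B₀'H B₂' BG BR cL c59 γ₈ γ' B₈ : ℝ),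
        (∀ v : Site 4, 0 < len v → 1 ≤ len v) ∧ (∀ μ : Fin 4, len (e μ) = 1) ∧
        0 ≤ B₀β ∧ C₂ = 2097152 * (((4 : ℕ) : ℝ) + 1) ^ 2 * (F.L : ℝ) ^ 2 ∧
        0 < cB9 ∧ 0 < B₀'H ∧ 0 ≤ B₂' ∧ 0 ≤ BG ∧ 0 ≤ BR ∧ 0 < cL ∧ 0 < c59 ∧ 1 ≤ γ₈ ∧ 0 ≤ γ' ∧
        2 ≤ 5 * ((4 : ℕ) : ℝ) * F.L * inp.B₀ ∧ inp.B₀ ≤ B₈ ∧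
        5 * ((4 : ℕ) : ℝ) * F.L * inp.B₀ + 2 * (γ' * inp.B₀) ≤ 5 * ((4 : ℕ) : ℝ) * F.L * B₈ ∧
        3 * (2 * ((4 : ℕ) : ℝ) * (F.L : ℝ) ^ 2) * BG * BR * (B₈ + γ₈) ≤ inp.B₀' * B₈ ∧
        (∀ i : {i : ZdIdx 4 F.L // (∀ j, i.Ω j = Set.univ) ∧ (∀ m j, i.Λs m j = {_y | j = m}) ∧ (∀ m j, i.Λb m j = {_c | j = m}) ∧ i.η = ((F.L : ℝ)⁻¹) ^ i.k},
          SockLettersRD (𝔸 := Matrix (Fin N) (Fin N) ℂ) F.L BG BR B₀'H B₂' cL i.1.η i.1.k i.1.Ω i.1.Λs) ∧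
        (∀ i : {i : ZdIdx 4 F.L // (∀ j, i.Ω j = Set.univ) ∧ (∀ m j, i.Λs m j = {_y | j = m}) ∧ (∀ m j, i.Λb m j = {_c | j = m}) ∧ i.η = ((F.L : ℝ)⁻¹) ^ i.k},
          ∀ α₀ : ℝ, 0 < α₀ → α₀ ≤ cL → ∀ U₀ : Site 4 → Fin 4 → (Matrix (Fin N) (Fin N) ℂ)ˣ, (∀ x κ, U₀ x κ ∈ unitaryUnits (Matrix (Fin N) (Fin N) ℂ)) →
          InAk F.L i.1.k i.1.η α₀ i.1.Ω U₀ →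
          ∃ (g Δ : (Site 4 → Matrix (Fin N) (Fin N) ℂ) →ₗ[ℂ] (Site 4 → Matrix (Fin N) (Fin N) ℂ)) (q : (Site 4 → Matrix (Fin N) (Fin N) ℂ) →ₗ[ℂ] (ℕ → Site 4 → Matrix (Fin N) (Fin N) ℂ))
            (qs : (ℕ → Site 4 → Matrix (Fin N) (Fin N) ℂ) →ₗ[ℂ] (Site 4 → Matrix (Fin N) (Fin N) ℂ)) (Aw c : (ℕ → Site 4 → Matrix (Fin N) (Fin N) ℂ) →ₗ[ℂ] (ℕ → Site 4 → Matrix (Fin N) (Fin N) ℂ))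
            (H' : XSpace 4 i.1.k (Matrix (Fin N) (Fin N) ℂ) →ₗ[ℂ] (Site 4 → Matrix (Fin N) (Fin N) ℂ)),
            (∀ x : Site 4 → Matrix (Fin N) (Fin N) ℂ, (∃ C : ℝ, ∀ y, ‖x y‖ ≤ C) → g (Δ x + qs (Aw (q x))) = x) ∧ (∀ φ, qs (c (q (g (g (qs φ))))) = qs φ) ∧
            (∀ (f : Site 4 → Matrix (Fin N) (Fin N) ℂ), ∀ x ∈ i.1.Ω 0, Δ f x = covLap i.1.η U₀ ((i.1.Ω 0).indicator f) x) ∧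
            (∀ (μ : ℕ → Site 4 → Matrix (Fin N) (Fin N) ℂ), ∀ x ∈ i.1.Ω 0, qs μ x = QT F.L i.1.k (i.1.Λs i.1.k) U₀ μ x) ∧
            (∀ (f : Site 4 → Matrix (Fin N) (Fin N) ℂ) (n : ℕ), n ≤ i.1.k → ∀ y ∈ i.1.Λs i.1.k n, q f n y = QprimeIter (zdBlocking 4 F.L) (bgT F.L U₀) n f y) ∧
            (∀ (f : Site 4 → Matrix (Fin N) (Fin N) ℂ) (n : ℕ) (y : Site 4), ¬ (n ≤ i.1.k ∧ y ∈ i.1.Λs i.1.k n) → q f n y = 0) ∧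
            (∀ (X : XSpace 4 i.1.k (Matrix (Fin N) (Fin N) ℂ)) (x : Site 4), ‖H' X x‖ ≤ B₀'H * ‖X‖) ∧
            (∀ n, n ≤ i.1.k → ∀ (X : XSpace 4 i.1.k (Matrix (Fin N) (Fin N) ℂ)), ∀ p ∈ {b : Site 4 × Fin 4 | SideTouches (i.1.Ω n) b.1 b.2},
              wt F.L i.1.η n * ‖covDerivFwd i.1.η U₀ p.2 (H' X) p.1‖ ≤ B₀'H * ‖X‖) ∧
            (∀ X : XSpace 4 i.1.k (Matrix (Fin N) (Fin N) ℂ), Bd2 F.L i.1.η i.1.k i.1.Ω (covLap i.1.η U₀ (H' X)) (B₂' * ‖X‖)) ∧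
            (∀ (Y : XSpace 4 i.1.k (Matrix (Fin N) (Fin N) ℂ)) (n : ℕ) (hn : n ≤ i.1.k) (y : Site 4), y ∈ i.1.Λs i.1.k n →
              QprimeIter (zdBlocking 4 F.L) (bgT F.L U₀) n (H' Y) y = Y (⟨n, Nat.lt_succ_of_le hn⟩, y)) ∧
            (∀ (f : Site 4 → Matrix (Fin N) (Fin N) ℂ) (r : ℝ), 0 ≤ r → Bd2 F.L i.1.η i.1.k i.1.Ω f r →
              (∀ x, ‖g f x‖ ≤ BG * r) ∧ ∀ n, n ≤ i.1.k → ∀ p ∈ {b : Site 4 × Fin 4 | SideTouches (i.1.Ω n) b.1 b.2},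
                wt F.L i.1.η n * ‖covDerivFwd i.1.η U₀ p.2 (g f) p.1‖ ≤ BG * r) ∧
            (∀ (f : Site 4 → Matrix (Fin N) (Fin N) ℂ) (r : ℝ), 0 ≤ r → Bd2 F.L i.1.η i.1.k i.1.Ω f r → Bd2 F.L i.1.η i.1.k i.1.Ω (f - g (qs (c (q (g f))))) (BR * r))) ∧
        (∀ i : {i : ZdIdx 4 F.L // (∀ j, i.Ω j = Set.univ) ∧ (∀ m j, i.Λs m j = {_y | j = m}) ∧ (∀ m j, i.Λb m j = {_c | j = m}) ∧ i.η = ((F.L : ℝ)⁻¹) ^ i.k},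
          SockB9P3 (𝔸 := Matrix (Fin N) (Fin N) ℂ) F.L inp.B₀ B₀β cB9 β len i.1.η i.1.k i.1.Ω i.1.Λs (fun m j => towerBondsP F.L i.1.Ω (i.1.Λs m) j)) ∧
        (∀ i : {i : ZdIdx 4 F.L // (∀ j, i.Ω j = Set.univ) ∧ (∀ m j, i.Λs m j = {_y | j = m}) ∧ (∀ m j, i.Λb m j = {_c | j = m}) ∧ i.η = ((F.L : ℝ)⁻¹) ^ i.k},
          ∀ α₀ α₁ : ℝ, 0 < α₀ → 0 < α₁ → α₀ + α₁ ≤ c59 →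
          ∀ U₀ U' : Site 4 → Fin 4 → (Matrix (Fin N) (Fin N) ℂ)ˣ, (∀ x κ, U₀ x κ ∈ unitaryUnits (Matrix (Fin N) (Fin N) ℂ)) → (∀ x κ, U' x κ ∈ unitaryUnits (Matrix (Fin N) (Fin N) ℂ)) →
          ∀ φ : Site 4 → Matrix (Fin N) (Fin N) ℂ, ((InR138 F.L i.1.k i.1.η (i.1.Ω 0) (i.1.Λs i.1.k) U₀ φ ∧ (∀ x, IsSelfAdjoint (φ x)) ∧ (∀ x, x ∉ i.1.Ω 0 → φ x = 0) ∧
              Bdd F.L i.1.k i.1.η (-(2 : ℝ)) (fun j (x : Site 4) => x ∈ i.1.Ω j) φ) ∧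
            msup F.L i.1.k i.1.η (-(2 : ℝ)) (fun j (x : Site 4) => x ∈ i.1.Ω j) φ < γ₈ * (α₀ + α₁)) →
          InAk F.L i.1.k i.1.η α₀ i.1.Ω U₀ → InAk F.L i.1.k i.1.η α₀ i.1.Ω (mulCfg U' U₀) → (∀ m, m ≤ i.1.k → InAx F.L m (i.1.Λs m) U₀ (mulCfg U' U₀)) →
          (∀ j, j ≤ i.1.k → ∀ (z : Site 4) (μ : Fin 4),
            ((∀ x, InBox (tlo F.L z j) (thi F.L z j) x → x ∈ i.1.Ω j) ∨ (∀ x, InBox (tlo F.L (z + e μ) j) (thi F.L (z + e μ) j) x → x ∈ i.1.Ω j)) →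
            ‖(avgIter F.L (mulCfg U' U₀) j z μ : Matrix (Fin N) (Fin N) ℂ) - (avgIter F.L U₀ j z μ : Matrix (Fin N) (Fin N) ℂ)‖ ≤ α₁) →
          (∀ b ∈ {b : Site 4 × Fin 4 | SideTouches (i.1.Ω 0) b.1 b.2}, ‖((U' b.1 b.2 : (Matrix (Fin N) (Fin N) ℂ)ˣ) : Matrix (Fin N) (Fin N) ℂ) - 1‖ ≤ α₁) →
          (∀ m, 1 ≤ m → m ≤ i.1.k → ∀ (u : Site 4 → (Matrix (Fin N) (Fin N) ℂ)ˣ) (W : Site 4 → Fin 4 → (Matrix (Fin N) (Fin N) ℂ)ˣ) (A' : Site 4 → Fin 4 → Matrix (Fin N) (Fin N) ℂ),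
            (∀ x, u x ∈ unitaryUnits (Matrix (Fin N) (Fin N) ℂ)) → mgauge U₀ u W = U' → Restr129 F.L m (i.1.Λs m) U₀ u → LanF146 F.L i.1.k i.1.η (i.1.Ω 0) i.1.Λs U₀ φ m W →
            (∀ y τ, IsSelfAdjoint (A' y τ)) →
            (∀ j, j ≤ m → ∀ y τ, SideTouches (i.1.Ω j) y τ →
            W y τ = cfgExp i.1.η A' y τ ∧ ‖A' y τ‖ ≤ (2 * (F.L * (5 * ((4 : ℕ) : ℝ) * F.L * B₈ * (α₀ + α₁))) + 8 * (8 * inp.B₀' * (5 * ((4 : ℕ) : ℝ) * F.L * B₈) * (α₀ + α₁))) * ((F.L : ℝ) ^ j * i.1.η)⁻¹) →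
            (∀ y τ, (∀ j, j ≤ m → ¬ SideTouches (i.1.Ω j) y τ) → A' y τ = 0) →
            msup F.L m i.1.η (-(1 : ℝ)) (fun j (b : Site 4 × Fin 4) => SideTouches (i.1.Ω j) b.1 b.2) (fun b => A' b.1 b.2)
            ≤ inp.B₀ * (bondNorm F.L m i.1.η (-(3 : ℝ)) i.1.Ω (fun x μ => Jcur i.1.η U₀ A' μ x)
            + wsup 1 (fun p : {p : ℕ × (Site 4 × Fin 4) // p.1 ≤ m ∧ p.2 ∈ towerBondsP F.L i.1.Ω (i.1.Λs m) p.1} =>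
            linCovIter F.L U₀ (iEta i.1.η A') p.1.1 p.1.2.1 p.1.2.2)) + γ' * inp.B₀ * (α₀ + α₁) ∧
            msup F.L m i.1.η (-(2 : ℝ)) (fun j (t : Fin 4 × Fin 4 × Site 4) => SideTouches (i.1.Ω j) t.2.2 t.2.1)
            (fun t => covDerivFwd i.1.η U₀ t.1 (fun z => A' z t.2.1) t.2.2)
            ≤ inp.B₀ * (bondNorm F.L m i.1.η (-(3 : ℝ)) i.1.Ω (fun x μ => Jcur i.1.η U₀ A' μ x)
            + wsup 1 (fun p : {p : ℕ × (Site 4 × Fin 4) // p.1 ≤ m ∧ p.2 ∈ towerBondsP F.L i.1.Ω (i.1.Λs m) p.1} =>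
            linCovIter F.L U₀ (iEta i.1.η A') p.1.1 p.1.2.1 p.1.2.2)) + γ' * inp.B₀ * (α₀ + α₁))))
    {G : T4Family → (Site 4 → Fin 4 → (MatA N)ˣ) → Site 4 → ℕ → ℝ → ℝ → ℝ → Prop} (hGm : ∀ F, RadiiMono 4 (G F))
    (hG : ∀ (F : T4Family) (U : Site 4 → Fin 4 → (MatA N)ˣ) (x : Site 4) (K : ℕ) (α₀ α₁ α₂ : ℝ), 2 ≤ K → G F U x K α₀ α₁ α₂ →
      ∃ (u : Site 4 → (MatA N)ˣ) (a : Site 4 → Fin 4 → MatA N),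
        (∀ z, u z ∈ unitaryUnits (MatA N)) ∧
        (∀ (y : Site 4) (τ : Fin 4), l1 (y - x) ≤ 2 → ((gaugeAct u U y τ : (MatA N)ˣ) : MatA N) = exp (a y τ)) ∧
        (∀ (y : Site 4) (τ : Fin 4), l1 (y - x) ≤ 2 → ‖a y τ‖ ≤ α₀) ∧
        (∀ (y : Site 4) (τ i : Fin 4), l1 (y - x) ≤ 1 → ‖fd i (fun z => a z τ) y‖ ≤ α₁) ∧
        (∀ (τ i l : Fin 4), ‖fd i (fd l (fun z => a z τ)) x‖ ≤ α₂))
    (C : T4Family → B11Thm1.Consts)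
    (hR : ∀ (F : T4Family) (k : ℕ) (ε₁ : ℝ), 0 < ε₁ → ε₁ ≤ (C F).a₁ → ∀ (V U : Site 4 → Fin 4 → (MatA N)ˣ), V ∈ sfClass 4 F.L (ne3NperOfRecord₁₁ F 0 0) ε₁ 0 →
      IsMinimiser 4 (sfClass 4 F.L (ne3NperOfRecord₁₁ F 0 0) ((C F).B₃ * ε₁)) F.L (ne3NperOfRecord₁₁ F 0 0) (k + 1) V U →
        ∀ x : Site 4, Regularity (torusVP 4 F.L (ne3NperOfRecord₁₁ F 0 0) (G F) (k + 1)) (C F).B₃ (C F).B₄ ε₁ U (x, F.L ^ (k + 1) - 1 + F.L ^ (k + 1) + 2)) :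
    ∃ (ℓ₃ : T4Family → NE3Letters₁₁) (B : T4Family → ℝ), N16LettersEnd N g ℓ₃ ∧
      (∀ F : T4Family, 0 < B F ∧ (ℓ₃ F).ε / B F ≤ (ℓ₃ F).b) ∧ (∀ F : T4Family, (C F).B₃ ≤ B F) ∧
      ∀ 𝔯 : RateReading₁₃CoPH N, N16PinnedLoose 𝔯 ℓ₃ B → N16HolderAtReading 𝔯 β :=
  exists_letters_n16HolderAtReading_loose_of_h5_reg910Slot_match hβ0 hβ1 hg
    (fun F => by
      obtain ⟨len, inp, B₀β, C₂, cB9, B₀'H, B₂', BG, BR, cL, c59, γ₈, γ', B₈, hlen, hlen1, hB₀β, hC₂eq, hcB9, hB₀'H, hB₂', hBG, hBR, hcL, hc59, hγ₈,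
        hγ', hB, hB₀8, hγB, hfreeS, SLet, SLetUB, SB9P, SH59src⟩ := hL F
      exact h5_of_lettersB9Src_allTorusPinned (N := N) F.hL.2 β hlen hlen1 inp hB₀β hC₂eq hcB9 hB₀'H hB₂' hBG hBR hcL hc59 hγ₈ hγ' hB hB₀8 hγB
        hfreeS SLet SLetUB SB9P SH59src)
    hGm hG C hR

/-- **THE SAME WITH NODE N19's TWO FURTHER RADIUS GUARDS** `ε₁ ≤ 1∕4 ∧ 4·ε₁ ≤ c'` for a `c' > 0` with `gradConst 4 c' = g F` (module 47's `…_match_n19rows`, typed ahead for a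
located next row (t-N16b); not consumed by v5) — with node N05 read as the four letters.  Nothing of Bałaban is proved.
[cite: Balaban1985Variational, Thm 1 (8)–(10) p.279; Balaban1985BackgroundPropagators, Thm 3.3 p.398] [folklore] -/
theorem exists_letters_n16HolderAtReading_loose_of_lettersB9Src_reg910Slot_match_n19rows {g : T4Family → ℝ} (hg : ∀ F, 0 < g F)
    (hL : ∀ F : T4Family, letI : CStarAlgebra (Matrix (Fin N) (Fin N) ℂ) := {}
  ∃ (len : Site 4 → ℝ) (inp : B8.B9Inputs) (B₀β C₂ cB9 B₀'H B₂' BG BR cL c59 γ₈ γ' B₈ : ℝ),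
        (∀ v : Site 4, 0 < len v → 1 ≤ len v) ∧ (∀ μ : Fin 4, len (e μ) = 1) ∧
        0 ≤ B₀β ∧ C₂ = 2097152 * (((4 : ℕ) : ℝ) + 1) ^ 2 * (F.L : ℝ) ^ 2 ∧
        0 < cB9 ∧ 0 < B₀'H ∧ 0 ≤ B₂' ∧ 0 ≤ BG ∧ 0 ≤ BR ∧ 0 < cL ∧ 0 < c59 ∧ 1 ≤ γ₈ ∧ 0 ≤ γ' ∧
        2 ≤ 5 * ((4 : ℕ) : ℝ) * F.L * inp.B₀ ∧ inp.B₀ ≤ B₈ ∧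
        5 * ((4 : ℕ) : ℝ) * F.L * inp.B₀ + 2 * (γ' * inp.B₀) ≤ 5 * ((4 : ℕ) : ℝ) * F.L * B₈ ∧
        3 * (2 * ((4 : ℕ) : ℝ) * (F.L : ℝ) ^ 2) * BG * BR * (B₈ + γ₈) ≤ inp.B₀' * B₈ ∧
        (∀ i : {i : ZdIdx 4 F.L // (∀ j, i.Ω j = Set.univ) ∧ (∀ m j, i.Λs m j = {_y | j = m}) ∧ (∀ m j, i.Λb m j = {_c | j = m}) ∧ i.η = ((F.L : ℝ)⁻¹) ^ i.k},
          SockLettersRD (𝔸 := Matrix (Fin N) (Fin N) ℂ) F.L BG BR B₀'H B₂' cL i.1.η i.1.k i.1.Ω i.1.Λs) ∧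
        (∀ i : {i : ZdIdx 4 F.L // (∀ j, i.Ω j = Set.univ) ∧ (∀ m j, i.Λs m j = {_y | j = m}) ∧ (∀ m j, i.Λb m j = {_c | j = m}) ∧ i.η = ((F.L : ℝ)⁻¹) ^ i.k},
          ∀ α₀ : ℝ, 0 < α₀ → α₀ ≤ cL → ∀ U₀ : Site 4 → Fin 4 → (Matrix (Fin N) (Fin N) ℂ)ˣ, (∀ x κ, U₀ x κ ∈ unitaryUnits (Matrix (Fin N) (Fin N) ℂ)) →
          InAk F.L i.1.k i.1.η α₀ i.1.Ω U₀ →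
          ∃ (g Δ : (Site 4 → Matrix (Fin N) (Fin N) ℂ) →ₗ[ℂ] (Site 4 → Matrix (Fin N) (Fin N) ℂ)) (q : (Site 4 → Matrix (Fin N) (Fin N) ℂ) →ₗ[ℂ] (ℕ → Site 4 → Matrix (Fin N) (Fin N) ℂ))
            (qs : (ℕ → Site 4 → Matrix (Fin N) (Fin N) ℂ) →ₗ[ℂ] (Site 4 → Matrix (Fin N) (Fin N) ℂ)) (Aw c : (ℕ → Site 4 → Matrix (Fin N) (Fin N) ℂ) →ₗ[ℂ] (ℕ → Site 4 → Matrix (Fin N) (Fin N) ℂ))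
            (H' : XSpace 4 i.1.k (Matrix (Fin N) (Fin N) ℂ) →ₗ[ℂ] (Site 4 → Matrix (Fin N) (Fin N) ℂ)),
            (∀ x : Site 4 → Matrix (Fin N) (Fin N) ℂ, (∃ C : ℝ, ∀ y, ‖x y‖ ≤ C) → g (Δ x + qs (Aw (q x))) = x) ∧ (∀ φ, qs (c (q (g (g (qs φ))))) = qs φ) ∧
            (∀ (f : Site 4 → Matrix (Fin N) (Fin N) ℂ), ∀ x ∈ i.1.Ω 0, Δ f x = covLap i.1.η U₀ ((i.1.Ω 0).indicator f) x) ∧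
            (∀ (μ : ℕ → Site 4 → Matrix (Fin N) (Fin N) ℂ), ∀ x ∈ i.1.Ω 0, qs μ x = QT F.L i.1.k (i.1.Λs i.1.k) U₀ μ x) ∧
            (∀ (f : Site 4 → Matrix (Fin N) (Fin N) ℂ) (n : ℕ), n ≤ i.1.k → ∀ y ∈ i.1.Λs i.1.k n, q f n y = QprimeIter (zdBlocking 4 F.L) (bgT F.L U₀) n f y) ∧
            (∀ (f : Site 4 → Matrix (Fin N) (Fin N) ℂ) (n : ℕ) (y : Site 4), ¬ (n ≤ i.1.k ∧ y ∈ i.1.Λs i.1.k n) → q f n y = 0) ∧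
            (∀ (X : XSpace 4 i.1.k (Matrix (Fin N) (Fin N) ℂ)) (x : Site 4), ‖H' X x‖ ≤ B₀'H * ‖X‖) ∧
            (∀ n, n ≤ i.1.k → ∀ (X : XSpace 4 i.1.k (Matrix (Fin N) (Fin N) ℂ)), ∀ p ∈ {b : Site 4 × Fin 4 | SideTouches (i.1.Ω n) b.1 b.2},
              wt F.L i.1.η n * ‖covDerivFwd i.1.η U₀ p.2 (H' X) p.1‖ ≤ B₀'H * ‖X‖) ∧
            (∀ X : XSpace 4 i.1.k (Matrix (Fin N) (Fin N) ℂ), Bd2 F.L i.1.η i.1.k i.1.Ω (covLap i.1.η U₀ (H' X)) (B₂' * ‖X‖)) ∧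
            (∀ (Y : XSpace 4 i.1.k (Matrix (Fin N) (Fin N) ℂ)) (n : ℕ) (hn : n ≤ i.1.k) (y : Site 4), y ∈ i.1.Λs i.1.k n →
              QprimeIter (zdBlocking 4 F.L) (bgT F.L U₀) n (H' Y) y = Y (⟨n, Nat.lt_succ_of_le hn⟩, y)) ∧
            (∀ (f : Site 4 → Matrix (Fin N) (Fin N) ℂ) (r : ℝ), 0 ≤ r → Bd2 F.L i.1.η i.1.k i.1.Ω f r →
              (∀ x, ‖g f x‖ ≤ BG * r) ∧ ∀ n, n ≤ i.1.k → ∀ p ∈ {b : Site 4 × Fin 4 | SideTouches (i.1.Ω n) b.1 b.2},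
                wt F.L i.1.η n * ‖covDerivFwd i.1.η U₀ p.2 (g f) p.1‖ ≤ BG * r) ∧
            (∀ (f : Site 4 → Matrix (Fin N) (Fin N) ℂ) (r : ℝ), 0 ≤ r → Bd2 F.L i.1.η i.1.k i.1.Ω f r → Bd2 F.L i.1.η i.1.k i.1.Ω (f - g (qs (c (q (g f))))) (BR * r))) ∧
        (∀ i : {i : ZdIdx 4 F.L // (∀ j, i.Ω j = Set.univ) ∧ (∀ m j, i.Λs m j = {_y | j = m}) ∧ (∀ m j, i.Λb m j = {_c | j = m}) ∧ i.η = ((F.L : ℝ)⁻¹) ^ i.k},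
          SockB9P3 (𝔸 := Matrix (Fin N) (Fin N) ℂ) F.L inp.B₀ B₀β cB9 β len i.1.η i.1.k i.1.Ω i.1.Λs (fun m j => towerBondsP F.L i.1.Ω (i.1.Λs m) j)) ∧
        (∀ i : {i : ZdIdx 4 F.L // (∀ j, i.Ω j = Set.univ) ∧ (∀ m j, i.Λs m j = {_y | j = m}) ∧ (∀ m j, i.Λb m j = {_c | j = m}) ∧ i.η = ((F.L : ℝ)⁻¹) ^ i.k},
          ∀ α₀ α₁ : ℝ, 0 < α₀ → 0 < α₁ → α₀ + α₁ ≤ c59 →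
          ∀ U₀ U' : Site 4 → Fin 4 → (Matrix (Fin N) (Fin N) ℂ)ˣ, (∀ x κ, U₀ x κ ∈ unitaryUnits (Matrix (Fin N) (Fin N) ℂ)) → (∀ x κ, U' x κ ∈ unitaryUnits (Matrix (Fin N) (Fin N) ℂ)) →
          ∀ φ : Site 4 → Matrix (Fin N) (Fin N) ℂ, ((InR138 F.L i.1.k i.1.η (i.1.Ω 0) (i.1.Λs i.1.k) U₀ φ ∧ (∀ x, IsSelfAdjoint (φ x)) ∧ (∀ x, x ∉ i.1.Ω 0 → φ x = 0) ∧
              Bdd F.L i.1.k i.1.η (-(2 : ℝ)) (fun j (x : Site 4) => x ∈ i.1.Ω j) φ) ∧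
            msup F.L i.1.k i.1.η (-(2 : ℝ)) (fun j (x : Site 4) => x ∈ i.1.Ω j) φ < γ₈ * (α₀ + α₁)) →
          InAk F.L i.1.k i.1.η α₀ i.1.Ω U₀ → InAk F.L i.1.k i.1.η α₀ i.1.Ω (mulCfg U' U₀) → (∀ m, m ≤ i.1.k → InAx F.L m (i.1.Λs m) U₀ (mulCfg U' U₀)) →
          (∀ j, j ≤ i.1.k → ∀ (z : Site 4) (μ : Fin 4),
            ((∀ x, InBox (tlo F.L z j) (thi F.L z j) x → x ∈ i.1.Ω j) ∨ (∀ x, InBox (tlo F.L (z + e μ) j) (thi F.L (z + e μ) j) x → x ∈ i.1.Ω j)) →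
            ‖(avgIter F.L (mulCfg U' U₀) j z μ : Matrix (Fin N) (Fin N) ℂ) - (avgIter F.L U₀ j z μ : Matrix (Fin N) (Fin N) ℂ)‖ ≤ α₁) →
          (∀ b ∈ {b : Site 4 × Fin 4 | SideTouches (i.1.Ω 0) b.1 b.2}, ‖((U' b.1 b.2 : (Matrix (Fin N) (Fin N) ℂ)ˣ) : Matrix (Fin N) (Fin N) ℂ) - 1‖ ≤ α₁) →
          (∀ m, 1 ≤ m → m ≤ i.1.k → ∀ (u : Site 4 → (Matrix (Fin N) (Fin N) ℂ)ˣ) (W : Site 4 → Fin 4 → (Matrix (Fin N) (Fin N) ℂ)ˣ) (A' : Site 4 → Fin 4 → Matrix (Fin N) (Fin N) ℂ),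
            (∀ x, u x ∈ unitaryUnits (Matrix (Fin N) (Fin N) ℂ)) → mgauge U₀ u W = U' → Restr129 F.L m (i.1.Λs m) U₀ u → LanF146 F.L i.1.k i.1.η (i.1.Ω 0) i.1.Λs U₀ φ m W →
            (∀ y τ, IsSelfAdjoint (A' y τ)) →
            (∀ j, j ≤ m → ∀ y τ, SideTouches (i.1.Ω j) y τ →
            W y τ = cfgExp i.1.η A' y τ ∧ ‖A' y τ‖ ≤ (2 * (F.L * (5 * ((4 : ℕ) : ℝ) * F.L * B₈ * (α₀ + α₁))) + 8 * (8 * inp.B₀' * (5 * ((4 : ℕ) : ℝ) * F.L * B₈) * (α₀ + α₁))) * ((F.L : ℝ) ^ j * i.1.η)⁻¹) →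
            (∀ y τ, (∀ j, j ≤ m → ¬ SideTouches (i.1.Ω j) y τ) → A' y τ = 0) →
            msup F.L m i.1.η (-(1 : ℝ)) (fun j (b : Site 4 × Fin 4) => SideTouches (i.1.Ω j) b.1 b.2) (fun b => A' b.1 b.2)
            ≤ inp.B₀ * (bondNorm F.L m i.1.η (-(3 : ℝ)) i.1.Ω (fun x μ => Jcur i.1.η U₀ A' μ x)
            + wsup 1 (fun p : {p : ℕ × (Site 4 × Fin 4) // p.1 ≤ m ∧ p.2 ∈ towerBondsP F.L i.1.Ω (i.1.Λs m) p.1} =>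
            linCovIter F.L U₀ (iEta i.1.η A') p.1.1 p.1.2.1 p.1.2.2)) + γ' * inp.B₀ * (α₀ + α₁) ∧
            msup F.L m i.1.η (-(2 : ℝ)) (fun j (t : Fin 4 × Fin 4 × Site 4) => SideTouches (i.1.Ω j) t.2.2 t.2.1)
            (fun t => covDerivFwd i.1.η U₀ t.1 (fun z => A' z t.2.1) t.2.2)
            ≤ inp.B₀ * (bondNorm F.L m i.1.η (-(3 : ℝ)) i.1.Ω (fun x μ => Jcur i.1.η U₀ A' μ x)
            + wsup 1 (fun p : {p : ℕ × (Site 4 × Fin 4) // p.1 ≤ m ∧ p.2 ∈ towerBondsP F.L i.1.Ω (i.1.Λs m) p.1} =>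
            linCovIter F.L U₀ (iEta i.1.η A') p.1.1 p.1.2.1 p.1.2.2)) + γ' * inp.B₀ * (α₀ + α₁))))
    {G : T4Family → (Site 4 → Fin 4 → (MatA N)ˣ) → Site 4 → ℕ → ℝ → ℝ → ℝ → Prop} (hGm : ∀ F, RadiiMono 4 (G F))
    (hG : ∀ (F : T4Family) (U : Site 4 → Fin 4 → (MatA N)ˣ) (x : Site 4) (K : ℕ) (α₀ α₁ α₂ : ℝ), 2 ≤ K → G F U x K α₀ α₁ α₂ →
      ∃ (u : Site 4 → (MatA N)ˣ) (a : Site 4 → Fin 4 → MatA N),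
        (∀ z, u z ∈ unitaryUnits (MatA N)) ∧
        (∀ (y : Site 4) (τ : Fin 4), l1 (y - x) ≤ 2 → ((gaugeAct u U y τ : (MatA N)ˣ) : MatA N) = exp (a y τ)) ∧
        (∀ (y : Site 4) (τ : Fin 4), l1 (y - x) ≤ 2 → ‖a y τ‖ ≤ α₀) ∧
        (∀ (y : Site 4) (τ i : Fin 4), l1 (y - x) ≤ 1 → ‖fd i (fun z => a z τ) y‖ ≤ α₁) ∧
        (∀ (τ i l : Fin 4), ‖fd i (fd l (fun z => a z τ)) x‖ ≤ α₂))
    (C : T4Family → B11Thm1.Consts)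
    (hR : ∀ (F : T4Family) (k : ℕ) (ε₁ : ℝ), 0 < ε₁ → ε₁ ≤ (C F).a₁ → ∀ (V U : Site 4 → Fin 4 → (MatA N)ˣ), V ∈ sfClass 4 F.L (ne3NperOfRecord₁₁ F 0 0) ε₁ 0 →
      IsMinimiser 4 (sfClass 4 F.L (ne3NperOfRecord₁₁ F 0 0) ((C F).B₃ * ε₁)) F.L (ne3NperOfRecord₁₁ F 0 0) (k + 1) V U →
        ∀ x : Site 4, Regularity (torusVP 4 F.L (ne3NperOfRecord₁₁ F 0 0) (G F) (k + 1)) (C F).B₃ (C F).B₄ ε₁ U (x, F.L ^ (k + 1) - 1 + F.L ^ (k + 1) + 2)) :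
    ∃ (ℓ₃ : T4Family → NE3Letters₁₁) (B : T4Family → ℝ) (c' : T4Family → ℝ), N16LettersEnd N g ℓ₃ ∧
      (∀ F : T4Family, 0 < B F ∧ (ℓ₃ F).ε / B F ≤ (ℓ₃ F).b) ∧ (∀ F : T4Family, (C F).B₃ ≤ B F) ∧
      (∀ F : T4Family, 0 < c' F ∧ gradConst 4 (c' F) = g F ∧ (ℓ₃ F).ε / B F ≤ 1 / 4 ∧ 4 * ((ℓ₃ F).ε / B F) ≤ c' F) ∧
      ∀ 𝔯 : RateReading₁₃CoPH N, N16PinnedLoose 𝔯 ℓ₃ B → N16HolderAtReading 𝔯 β :=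
  exists_letters_n16HolderAtReading_loose_of_h5_reg910Slot_match_n19rows hβ0 hβ1 hg
    (fun F => by
      obtain ⟨len, inp, B₀β, C₂, cB9, B₀'H, B₂', BG, BR, cL, c59, γ₈, γ', B₈, hlen, hlen1, hB₀β, hC₂eq, hcB9, hB₀'H, hB₂', hBG, hBR, hcL, hc59, hγ₈,
        hγ', hB, hB₀8, hγB, hfreeS, SLet, SLetUB, SB9P, SH59src⟩ := hL F
      exact h5_of_lettersB9Src_allTorusPinned (N := N) F.hL.2 β hlen hlen1 inp hB₀β hC₂eq hcB9 hB₀'H hB₂' hBG hBR hcL hc59 hγ₈ hγ' hB hB₀8 hγB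
        hfreeS SLet SLetUB SB9P SH59src)
    hGm hG C hR

end Producer

end Summit.QuantumFields.YangMills.BalabanUVNodes.N16PinnedLooseMatchOfLettersB9SrcSlot

end
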